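import Summits.QuantumFields.QCD.Theorems.WilsonQuarkChessboardFlatCellOptimalGaugeOrbit
import Summits.QuantumFields.QCD.Theorems.WilsonQuarkChessboardFlatCellOptimalStubLocalNormGainAllN

/-!
# The local half of `FlatCellOptimal` (crux stmt-QuantumFields-9307), Re form, every `N`, every even `L ≥ 4`

`stub_localFlatOptimumAllN` is LITERALLY the statement `LocalFlatOptimum` of the line's skeleton
(`Cruxes/FlatCellOptimal/Lines/birth.lean`, its `abbrev`s `dAP`, `tile`, `deficit` expanded): there are ONE flatness
scale `η > 0` and ONE mass window `δ > 0` such that for every colour number `N`, every even side `L ≥ 4`, every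
`U(N)` field `U`, every cell corner `c` and every bare mass `|m| < δ`, if every plaquette of the period-2 reflection
tiling `R_c U` has deficit `N − Re tr < η`, then `Re det_AP D_W[R_c U] ≤ Re det_AP D_W[1]` — the flat cell is a local
maximum of the all-axes-antiperiodic Wilson–Dirac determinant among reflection tilings, uniformly in `N` and `L`,
with no additive slack (the crux is tight on the flat orbit: `GaugeOrbit.apDet_tile_eq_of_flat`).

It is the norm form `LocalHalf.stub_localNormGainAllN` (the K-tracked, dimension-free, all-`N` transport of the
one-loop cell-gain chain: dimension-free log-determinant bounds `LogDetDimFree.stub_logDetDimFree`, the one-loop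
Hessian margin for every `N` and every `M = L/2 ≥ 2` `HessianMargin.stub_hessianMarginAllN` — computational lane,
resting on the interval-arithmetic certificates `CheckerCert0–3` of the sibling crux stmt-QuantumFields-9734 and
`BlockCertM4` —, the N-generic regauging `CellGauge.stub_cellGaugeAllN`, and the ported cone `Tadpole`,
`FreeTwistedFourier`, `GaugeCoercive`, `TangentDelta`, `FreeBlocks`, `BlockHessian`, `WardKernel`, `BlockReduction`,
`BlockMargins`, `BilinearBounds`, `MassLipschitz`, `UnitaryCell`, `CellDet`, `TilingData`, `OneLoop`, `CellGain`,
`BlockEstimate`) turned into the Re form by `GaugeOrbit.localFlatOptimum_of_normForm` (`‖dAP m 1‖ = Re dAP m 1`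
for `m > −1`, from the proved `QuarkChessboard`).  Pure theorem file.
-/

noncomputable section

open scoped BigOperators Classical Matrix ComplexConjugate
open Literature.MathematicalPhysics.QuantumLattice Literature.MathematicalPhysics.QuantumFieldTheory

namespace Summit.QuantumFields.QCD.Cruxes.FlatCellOptimal.LocalHalf

/-- **The local half of the crux `FlatCellOptimal`, Re form** (registered sub-goal `stub_localFlatOptimumAllN`;
literally the skeleton's `LocalFlatOptimum`): for ONE `η > 0` and ONE `δ > 0`, every `N`, every even `L ≥ 4`, every
`U(N)` field, corner and `|m| < δ`, an `η`-flat reflection tiling has `Re det_AP ≤` the free one. -/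
theorem stub_localFlatOptimumAllN : ∃ η : ℝ, 0 < η ∧ ∃ δ : ℝ, 0 < δ ∧ ∀ (N L : ℕ) [NeZero L], Even L → 4 ≤ L → ∀ (U : GaugeConfig 4 L (Matrix.unitaryGroup (Fin N) ℂ)) (c : Site 4 L) (m : ℝ), -δ < m → m < δ → (∀ (x : Site 4 L) (i j : Fin 4), (N : ℝ) - ((unitaryFundamentalRep (Fin N) ℂ) (plaquetteHolonomy (fun e : Edge 4 L => if (e.1 e.2 - c e.2).val % 2 = 0 then U (fun ν => c ν + (((e.1 ν - c ν).val % 2 : ℕ) : ZMod L), e.2) else (U (fun ν => c ν + (((Site.shift e.1 e.2 ν - c ν).val % 2 : ℕ) : ZMod L), e.2))⁻¹) x i j)).trace.re < η) → ((wilsonDirac (unitaryFundamentalRep (Fin N) ℂ) (fun e : Edge 4 L => if (e.1 e.2).val + 1 = L then -((fun e : Edge 4 L => if (e.1 e.2 - c e.2).val % 2 = 0 then U (fun ν => c ν + (((e.1 ν - c ν).val % 2 : ℕ) : ZMod L), e.2) else (U (fun ν => c ν + (((Site.shift e.1 e.2 ν - c ν).val % 2 : ℕ) : ZMod L), e.2))⁻¹)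 e) else (fun e : Edge 4 L => if (e.1 e.2 - c e.2).val % 2 = 0 then U (fun ν => c ν + (((e.1 ν - c ν).val % 2 : ℕ) : ZMod L), e.2) else (U (fun ν => c ν + (((Site.shift e.1 e.2 ν - c ν).val % 2 : ℕ) : ZMod L), e.2))⁻¹) e) m 1).det).re ≤ ((wilsonDirac (unitaryFundamentalRep (Fin N) ℂ) (fun e : Edge 4 L => if (e.1 e.2).val + 1 = L then -(1 : GaugeConfig 4 L (Matrix.unitaryGroup (Fin N) ℂ)) e else (1 : GaugeConfig 4 L (Matrix.unitaryGroup (Fin N) ℂ)) e) m 1).det).re :=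
  GaugeOrbit.localFlatOptimum_of_normForm stub_localNormGainAllN

end Summit.QuantumFields.QCD.Cruxes.FlatCellOptimal.LocalHalf

end
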